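import Mathlib
import Literature.Analysis.FluidPDE.VectorCalculus
import Literature.Analysis.FluidPDE.SteadyLiouvilleTsaiKit
import Summits.NavierStokesRegularity.NavierStokesRegularity.Theorems.ThreadingFluxErtelTowerDefs
import HarnessLib

/-!
# Crux `PoloidalLiouville` (stmt-NavierStokesRegularity-1222, W1), crux idea «radial-jerk-tower» (ns-idea-15 g7):
# PART A PORT — the kernel-checked algebraic cores of `ErtelTowerSketch.lean` v1.1 over the Defs twin

Support file (`--supports stmt-NavierStokesRegularity-1222`, helper; critic V21-P3 landing order «Part A first, by-name
reusable»).  Experiment cell `ns-wall-extremal`, width hand ns-wall-eng-5 g6, director KEY-NS #186.  0 kit.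
The 28 lemmas of Part A / A2 of `Cruxes/PoloidalLiouville/ErtelTowerSketch.lean` (sha12 0d546a01b9e9), proofs VERBATIM
(lint: `smul_apply`), restated over the Theorems-side objects of `ThreadingFluxErtelTowerDefs` (`polhodeDefect/₁/₂`, `dTau₁`,
`radialJerk`, `strain`, `topField`, `quadForm`): tangency/loop-law/level-two identities for `τ = Sx × x` (`tau_perp_x`,
`tau_perp_Sx`, `tau_dot_S2x`), the VANDERMONDE CLOSURE (`vandermonde_closure`, coordinate-free `strainTower_closure`), the
polhode defect (`polhode_order_one/two`, `cauchy_defect_factorisation`, `hasDerivAt_polhodeDefect/₁`, `polhodeDefect_zero`,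
`polhodeDefect_second_deriv(_ne_zero)`), the survivor skeleton (`dTau_radial`, `dTau_strain`, `survivor_balance`) and the
objects' pointwise identities (`gradient_radial`, `radialJerk_one`, `topField_tangent`, `topField_perp_strain`,
`topField_dot_strainSq`, `strain_dot_self`, `radialJerk_one_strain`), plus (Part A3) the coordinate calculus on `ℝ³`
used by the survivor file (`fderiv_coord_single`, `laplacian_coord`, `laplacian_const_mul_coord_mul_coord`; `contDiff_coord` is `ForcedTsai.contDiff_coord` in the tree, inlined here).

HONEST FRAME: finite algebra / one-variable calculus about the typed objects of one crux idea; closes no sketch Prop by itself;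
`PoloidalLiouville` (1222), `UnthreadedRigidity` (27585) and NS regularity OPEN.
-/

-- the summit and its single problem share the name (D-0017 nested layout)
set_option linter.dupNamespace false

noncomputable section

namespace Summit.NavierStokesRegularity.NavierStokesRegularity.Theorems.PoloidalLiouville.ErtelTower

open scoped BigOperators Topology InnerProductSpace RealInnerProductSpace Laplacian
open Filter Set Function
open Literature.Analysis.FluidPDE
open Summit.NavierStokesRegularity.NavierStokesRegularity.Theorems.PoloidalLiouville.HorizonTower (E3)

/-! ## Part A — kernel-checked algebraic cores (principal-axis coordinates of a strain `S = diag(a,b,c)`)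

Throughout Part A, `x₁ x₂ x₃` are the coordinates of `x − x₀` in a principal frame of the symmetric strain `S`,
`τ := Sx × x = ((b−c)x₂x₃, (c−a)x₃x₁, (a−b)x₁x₂)` is the Euler-top field (vortex lines = polhodes = sphere ∩ quadric),
and `ω = (ω₁, ω₂, ω₃)` is an arbitrary vector at `x`. -/

/-- `τ = Sx × x` is tangent to the spheres: `⟪τ, x⟫ = 0`. -/
theorem tau_perp_x (a b c x₁ x₂ x₃ : ℝ) :
    (b - c) * x₂ * x₃ * x₁ + (c - a) * x₃ * x₁ * x₂ + (a - b) * x₁ * x₂ * x₃ = 0 := by ring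

/-- `τ` passes level 1 of the tower in the strain (the loop law): `⟪τ, Sx⟫ = 0`. -/
theorem tau_perp_Sx (a b c x₁ x₂ x₃ : ℝ) :
    (b - c) * x₂ * x₃ * (a * x₁) + (c - a) * x₃ * x₁ * (b * x₂) + (a - b) * x₁ * x₂ * (c * x₃) = 0 := by ring

/-- Level 2 of the inviscid tower in the strain does NOT vanish: `⟪τ, S²x⟫ = −(a−b)(b−c)(c−a)·x₁x₂x₃`
(the triaxiality discriminant times the octant coordinate). -/
theorem tau_dot_S2x (a b c x₁ x₂ x₃ : ℝ) :
    (b - c) * x₂ * x₃ * (a ^ 2 * x₁) + (c - a) * x₃ * x₁ * (b ^ 2 * x₂) + (a - b) * x₁ * x₂ * (c ^ 2 * x₃)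
      = -((a - b) * (b - c) * (c - a)) * (x₁ * x₂ * x₃) := by ring

/-- VANDERMONDE CLOSURE (inviscid rigidity in a triaxial strain, pointwise core).  If the principal strains are
pairwise distinct and `x` lies off the principal planes, a vector orthogonal to the first three radial jerk gradients
`x, Sx, S²x` vanishes.  With Ertel's commutation (levels 0,1,2 of the tower) this is the whole proof of
`InviscidStrainRigidity` below. -/
theorem vandermonde_closure (a b c x₁ x₂ x₃ ω₁ ω₂ ω₃ : ℝ)
    (hab : a ≠ b) (hbc : b ≠ c) (hca : c ≠ a) (hx₁ : x₁ ≠ 0) (hx₂ : x₂ ≠ 0) (hx₃ : x₃ ≠ 0)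
    (h0 : ω₁ * x₁ + ω₂ * x₂ + ω₃ * x₃ = 0)
    (h1 : ω₁ * (a * x₁) + ω₂ * (b * x₂) + ω₃ * (c * x₃) = 0)
    (h2 : ω₁ * (a ^ 2 * x₁) + ω₂ * (b ^ 2 * x₂) + ω₃ * (c ^ 2 * x₃) = 0) :
    ω₁ = 0 ∧ ω₂ = 0 ∧ ω₃ = 0 := by
  have e1 : (a - b) * (a - c) * (ω₁ * x₁) = 0 := by
    linear_combination h2 - (b + c) * h1 + (b * c) * h0
  have e2 : (b - a) * (b - c) * (ω₂ * x₂) = 0 := by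
    linear_combination h2 - (a + c) * h1 + (a * c) * h0
  have e3 : (c - a) * (c - b) * (ω₃ * x₃) = 0 := by
    linear_combination h2 - (a + b) * h1 + (a * b) * h0
  have hab' : a - b ≠ 0 := sub_ne_zero.mpr hab
  have hba' : b - a ≠ 0 := sub_ne_zero.mpr (Ne.symm hab)
  have hbc' : b - c ≠ 0 := sub_ne_zero.mpr hbc
  have hcb' : c - b ≠ 0 := sub_ne_zero.mpr (Ne.symm hbc)
  have hca' : c - a ≠ 0 := sub_ne_zero.mpr hca
  have hac' : a - c ≠ 0 := sub_ne_zero.mpr (Ne.symm hca)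
  refine ⟨?_, ?_, ?_⟩
  · have : ω₁ * x₁ = 0 := by
      rcases mul_eq_zero.mp e1 with h | h
      · exact absurd h (mul_ne_zero hab' hac')
      · exact h
    rcases mul_eq_zero.mp this with h | h
    · exact h
    · exact absurd h hx₁
  · have : ω₂ * x₂ = 0 := by
      rcases mul_eq_zero.mp e2 with h | h
      · exact absurd h (mul_ne_zero hba' hbc')
      · exact h
    rcases mul_eq_zero.mp this with h | h
    · exact h
    · exact absurd h hx₂
  · have : ω₃ * x₃ = 0 := by
      rcases mul_eq_zero.mp e3 with h | h
      · exact absurd h (mul_ne_zero hca' hcb')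
      · exact h
    rcases mul_eq_zero.mp this with h | h
    · exact h
    · exact absurd h hx₃

/-- ORDER ONE of polhode threading vanishes identically (the loop law is passed): the coefficient
`a(b−c) + b(c−a) + c(a−b)` of the first time-derivative of the defect is `0`. -/
theorem polhode_order_one (a b c : ℝ) : a * (b - c) + b * (c - a) + c * (a - b) = 0 := by ring

/-- ORDER TWO of polhode threading: the coefficient `a²(b−c) + b²(c−a) + c²(a−b)` equals minus the
triaxiality discriminant. -/
theorem polhode_order_two (a b c : ℝ) :
    a ^ 2 * (b - c) + b ^ 2 * (c - a) + c ^ 2 * (a - b) = -((a - b) * (b - c) * (c - a)) := by ring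

/-- The CAUCHY (frozen-field) transport of `σ₀ τ` by the strain flow `x ↦ e^{tS}x` (tr S = 0) is, in principal
coordinates, `B(t,x) = σ₀(e^{−tS}x) · (e^{2at}(b−c)x₂x₃, e^{2bt}(c−a)x₃x₁, e^{2ct}(a−b)x₁x₂)`
([corpus:majda2002 p.25, Prop. 1.8]); its radial defect factorises as `⟪B, x⟫ = σ₀(…)·x₁x₂x₃·F(t)` with the
universal profile `F` below.  (Pointwise algebra of the factorisation; `ea, eb, ec` stand for `e^{2at}, e^{2bt}, e^{2ct}`.) -/
theorem cauchy_defect_factorisation (a b c ea eb ec s x₁ x₂ x₃ : ℝ) :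
    s * (ea * ((b - c) * x₂ * x₃)) * x₁ + s * (eb * ((c - a) * x₃ * x₁)) * x₂ + s * (ec * ((a - b) * x₁ * x₂)) * x₃
      = s * (x₁ * x₂ * x₃) * ((b - c) * ea + (c - a) * eb + (a - b) * ec) := by ring

/-- `d/ds e^{2ks} = 2k e^{2ks}`. -/
private theorem hasDerivAt_exp_lin (k t : ℝ) :
    HasDerivAt (fun s => Real.exp (2 * k * s)) (2 * k * Real.exp (2 * k * t)) t := by
  have h : HasDerivAt (fun s => 2 * k * s) (2 * k) t := by
    simpa using (hasDerivAt_id t).const_mul (2 * k)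
  have := h.exp
  simpa [mul_comm] using this

/-- `F′ = F₁` (the defect profile is differentiable with derivative `polhodeDefect₁`). -/
theorem hasDerivAt_polhodeDefect (a b c t : ℝ) :
    HasDerivAt (polhodeDefect a b c) (polhodeDefect₁ a b c t) t := by
  have ha := (hasDerivAt_exp_lin a t).const_mul (b - c)
  have hb := (hasDerivAt_exp_lin b t).const_mul (c - a)
  have hc := (hasDerivAt_exp_lin c t).const_mul (a - b)
  have h : HasDerivAt (fun s => (b - c) * Real.exp (2 * a * s) + (c - a) * Real.exp (2 * b * s)
      + (a - b) * Real.exp (2 * c * s))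
      ((b - c) * (2 * a * Real.exp (2 * a * t)) + (c - a) * (2 * b * Real.exp (2 * b * t))
        + (a - b) * (2 * c * Real.exp (2 * c * t))) t := (ha.add hb).add hc
  refine h.congr_deriv ?_
  unfold polhodeDefect₁
  ring

/-- `F₁′ = F₂`. -/
theorem hasDerivAt_polhodeDefect₁ (a b c t : ℝ) :
    HasDerivAt (polhodeDefect₁ a b c) (polhodeDefect₂ a b c t) t := by
  have ha := (hasDerivAt_exp_lin a t).const_mul ((b - c) * (2 * a))
  have hb := (hasDerivAt_exp_lin b t).const_mul ((c - a) * (2 * b))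
  have hc := (hasDerivAt_exp_lin c t).const_mul ((a - b) * (2 * c))
  have h : HasDerivAt (fun s => (b - c) * (2 * a) * Real.exp (2 * a * s)
      + (c - a) * (2 * b) * Real.exp (2 * b * s) + (a - b) * (2 * c) * Real.exp (2 * c * s))
      ((b - c) * (2 * a) * (2 * a * Real.exp (2 * a * t)) + (c - a) * (2 * b) * (2 * b * Real.exp (2 * b * t))
        + (a - b) * (2 * c) * (2 * c * Real.exp (2 * c * t))) t := (ha.add hb).add hc
  refine h.congr_deriv ?_
  unfold polhodeDefect₂
  ring

/-- The defect and its first derivative vanish at `t = 0` (tangency at t = 0; loop law at order one) … -/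
theorem polhodeDefect_zero (a b c : ℝ) : polhodeDefect a b c 0 = 0 ∧ polhodeDefect₁ a b c 0 = 0 := by
  constructor
  · simp only [polhodeDefect, mul_zero, Real.exp_zero, mul_one]; ring
  · simp only [polhodeDefect₁, mul_zero, Real.exp_zero, mul_one]; ring

/-- … and the second derivative at `t = 0` is `−4(a−b)(b−c)(c−a) ≠ 0` for pairwise distinct principal strains:
POLHODE LOOPS THREAD AT ORDER TWO under inviscid transport by their own strain, at a rate proportional to the
triaxiality discriminant (kernel form of the order-two threading found numerically on shells by g3). -/
theorem polhodeDefect_second_deriv (a b c : ℝ) :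
    polhodeDefect₂ a b c 0 = -4 * ((a - b) * (b - c) * (c - a)) := by
  simp [polhodeDefect₂]; ring

/-- … hence non-zero for pairwise distinct principal strains. -/
theorem polhodeDefect_second_deriv_ne_zero (a b c : ℝ) (hab : a ≠ b) (hbc : b ≠ c) (hca : c ≠ a) :
    polhodeDefect₂ a b c 0 ≠ 0 := by
  rw [polhodeDefect_second_deriv]
  have hab' : a - b ≠ 0 := sub_ne_zero.mpr hab
  have hbc' : b - c ≠ 0 := sub_ne_zero.mpr hbc
  have hca' : c - a ≠ 0 := sub_ne_zero.mpr hca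
  have : (a - b) * (b - c) * (c - a) ≠ 0 := mul_ne_zero (mul_ne_zero hab' hbc') hca'
  intro h
  apply this
  linarith

/-! ### The viscous survivor `B⋆ = exp(xᵀSx/2ν)·(Sx × x)` — algebraic skeleton

`τ(x) = Sx × x` is a quadratic (bilinear-diagonal) field; its derivative at `x` in the direction `w` is
`dτ(x)[w] = Sw × x + Sx × w`, written out below in principal coordinates.  The three calculus facts used in the card,
`(x·∇)τ = 2τ`, `(Sx·∇)τ = −Sτ` (needs `tr S = 0`) and — for `σ = exp(xᵀSx/2ν)` — `∇σ = (σ/ν)Sx`,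
`Δσ = (σ/ν²)‖Sx‖²` (again `tr S = 0`), reduce the steady passive equation `−(Sx·∇)B + SB + νΔB = 0` for `B = στ`
to the identity `survivor_balance`. -/

/-- Euler homogeneity `(x·∇)τ = 2τ` (first component; cyclic). -/
theorem dTau_radial (b c x₂ x₃ : ℝ) : dTau₁ b c x₂ x₃ x₂ x₃ = 2 * ((b - c) * x₂ * x₃) := by
  unfold dTau₁; ring

/-- Strain transport of the top field: `(Sx·∇)τ = −Sτ` when `a + b + c = 0` (first component; cyclic). -/
theorem dTau_strain (a b c x₂ x₃ : ℝ) (htr : a + b + c = 0) :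
    dTau₁ b c x₂ x₃ (b * x₂) (c * x₃) = -(a * ((b - c) * x₂ * x₃)) := by
  have hbc : b + c = -a := by linarith
  unfold dTau₁
  have : (b - c) * (b * x₂ * x₃ + x₂ * (c * x₃)) = (b + c) * ((b - c) * x₂ * x₃) := by ring
  rw [this, hbc]; ring

/-- SURVIVOR BALANCE.  With `q = ‖Sx‖²`, `τ₁` a component of `τ`, `(Sτ)₁ = a τ₁` the same component of `Sτ`, and the
calculus facts above substituted (`∇σ = (σ/ν)Sx`, `Δσ = (σ/ν²)q`, `(Sx·∇)τ = −Sτ`, `Δτ = 0`), the steady passive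
viscous equation `−[(Sx·∇σ)τ + σ(Sx·∇)τ] + σSτ + ν[(Δσ)τ + 2(∇σ·∇)τ + σΔτ] = 0` holds identically (after dividing by
`σ > 0`).  This is the algebraic content of «`B⋆ = exp(xᵀSx/2ν)(Sx × x)` solves the linearised vorticity equation
about the strain `Sx`» (`StrainShadowSurvivor`). -/
theorem survivor_balance (ν q τ₁ a : ℝ) (hν : ν ≠ 0) :
    -((1 / ν) * q * τ₁ + (-(a * τ₁))) + a * τ₁ + ν * ((1 / ν ^ 2) * q * τ₁ + 2 * ((1 / ν) * (-(a * τ₁))) + 0) = 0 := by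
  field_simp
  ring


/-! ## Part A2 — the objects on `EuclideanSpace ℝ (Fin 3)` and their kernel-checked pointwise identities -/


/-- KERNEL: `∇(½‖x − x₀‖²) = x − x₀` (level 0 of the tower has gradient the position vector). -/
theorem gradient_radial (x₀ x : E3) : gradient (fun y : E3 => ‖y - x₀‖ ^ 2 / 2) x = x - x₀ := by
  have h1 : HasFDerivAt (fun y : E3 => y - x₀) (ContinuousLinearMap.id ℝ E3) x :=
    (hasFDerivAt_id x).sub_const x₀
  have h2 : HasFDerivAt (fun y : E3 => ‖y - x₀‖ ^ 2)
      ((2 : ℕ) • (innerSL ℝ (x - x₀)).comp (ContinuousLinearMap.id ℝ E3)) x := h1.norm_sq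
  have h3 := h2.const_mul (1 / 2 : ℝ)
  have h4 : HasFDerivAt (fun y : E3 => ‖y - x₀‖ ^ 2 / 2)
      ((1 / 2 : ℝ) • ((2 : ℕ) • (innerSL ℝ (x - x₀)).comp (ContinuousLinearMap.id ℝ E3))) x := by
    have hf : (fun y : E3 => ‖y - x₀‖ ^ 2 / 2) = fun y => (1 / 2 : ℝ) * ‖y - x₀‖ ^ 2 := by
      funext y; ring
    rw [hf]; exact h3
  have h5 : HasGradientAt (fun y : E3 => ‖y - x₀‖ ^ 2 / 2) (x - x₀) x := by
    rw [hasGradientAt_iff_hasFDerivAt]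
    refine h4.congr_fderiv ?_
    ext y
    simp only [smul_apply, ContinuousLinearMap.comp_apply, ContinuousLinearMap.id_apply,
      innerSL_apply_apply, InnerProductSpace.toDual_apply_apply, smul_eq_mul, nsmul_eq_mul]
    push_cast
    ring
  exact h5.gradient

/-- KERNEL: level 1 of the tower IS the loop momentum, `θ₁ = ⟪u, x − x₀⟫`, for every drift. -/
theorem radialJerk_one (u : ℝ → E3 → E3) (x₀ : E3) (t : ℝ) (x : E3) :
    radialJerk u x₀ 1 t x = inner ℝ (u t x) (x - x₀) := by
  have h0 : radialJerk u x₀ 0 t = fun y : E3 => ‖y - x₀‖ ^ 2 / 2 := rfl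
  show deriv (fun s => radialJerk u x₀ 0 s x) t + inner ℝ (u t x) (gradient (radialJerk u x₀ 0 t) x)
      = inner ℝ (u t x) (x - x₀)
  rw [h0, gradient_radial]
  have : (fun s : ℝ => radialJerk u x₀ 0 s x) = fun _ => ‖x - x₀‖ ^ 2 / 2 := rfl
  rw [this, deriv_const]
  simp

/-- KERNEL: `τ = Sx × x` is tangent to the spheres. -/
theorem topField_tangent (a b c : ℝ) (x : E3) : inner ℝ (topField a b c x) x = 0 := by
  simp [topField, EuclideanSpace.inner_eq_star_dotProduct, dotProduct, Fin.sum_univ_three]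
  ring

/-- KERNEL: `τ` passes level 1 of the strain tower: `⟪τ, Sx⟫ = 0`. -/
theorem topField_perp_strain (a b c : ℝ) (x : E3) : inner ℝ (topField a b c x) (strain a b c x) = 0 := by
  simp [topField, strain, EuclideanSpace.inner_eq_star_dotProduct, dotProduct, Fin.sum_univ_three]
  ring

/-- KERNEL: level 2 of the inviscid strain tower does NOT vanish on `τ`:
`⟪τ, S²x⟫ = −(a−b)(b−c)(c−a)·x₀x₁x₂`. -/
theorem topField_dot_strainSq (a b c : ℝ) (x : E3) :
    inner ℝ (topField a b c x) (strain (a ^ 2) (b ^ 2) (c ^ 2) x)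
      = -((a - b) * (b - c) * (c - a)) * (x 0 * x 1 * x 2) := by
  simp [topField, strain, EuclideanSpace.inner_eq_star_dotProduct, dotProduct, Fin.sum_univ_three]
  ring

/-- KERNEL: `⟪Sx, x⟫ = xᵀSx`. -/
theorem strain_dot_self (a b c : ℝ) (x : E3) : inner ℝ (strain a b c x) x = quadForm a b c x := by
  simp [strain, quadForm, EuclideanSpace.inner_eq_star_dotProduct, dotProduct, Fin.sum_univ_three]
  ring

/-- KERNEL: in the steady strain drift the first radial jerk is the quadric `xᵀSx` (so its vortex-line integrals are
`‖x‖²` and `xᵀSx`: vortex lines of any inviscid unthreaded shadow at a strain centre are POLHODES). -/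
theorem radialJerk_one_strain (a b c t : ℝ) (x : E3) :
    radialJerk (fun _ => strain a b c) 0 1 t x = quadForm a b c x := by
  rw [radialJerk_one, sub_zero, strain_dot_self]

/-- KERNEL (coordinate-free form of `vandermonde_closure`): a vector orthogonal to `x, Sx, S²x` at a point off the
principal planes of a triaxial strain is zero. -/
theorem strainTower_closure (a b c : ℝ) (x B : E3) (hab : a ≠ b) (hbc : b ≠ c) (hca : c ≠ a)
    (hx0 : x 0 ≠ 0) (hx1 : x 1 ≠ 0) (hx2 : x 2 ≠ 0)
    (h0 : inner ℝ B x = 0) (h1 : inner ℝ B (strain a b c x) = 0)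
    (h2 : inner ℝ B (strain (a ^ 2) (b ^ 2) (c ^ 2) x) = 0) : B = 0 := by
  simp [strain, EuclideanSpace.inner_eq_star_dotProduct, dotProduct, Fin.sum_univ_three] at h0 h1 h2
  have key := vandermonde_closure a b c (x 0) (x 1) (x 2) (B 0) (B 1) (B 2) hab hbc hca hx0 hx1 hx2
    (by linarith) (by linarith) (by linarith)
  obtain ⟨k0, k1, k2⟩ := key
  ext i
  fin_cases i <;> simp_all


/-! ## Part A3 — coordinate calculus on `ℝ³` (used by the survivor file) -/

/-! ### Coordinate calculus on `ℝ³` -/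

/-- `∂ₖ yᵢ = δᵢₖ`. -/
theorem fderiv_coord_single (x : E3) (i k : Fin 3) :
    fderiv ℝ (fun y : E3 => y i) x (EuclideanSpace.single k (1 : ℝ)) = if i = k then 1 else 0 := by
  have h : HasFDerivAt (fun y : E3 => y i) (EuclideanSpace.proj (𝕜 := ℝ) (ι := Fin 3) i) x :=
    (EuclideanSpace.proj (𝕜 := ℝ) (ι := Fin 3) i).hasFDerivAt
  rw [h.fderiv]
  show (EuclideanSpace.single k (1 : ℝ) : E3) i = _
  simp

/-- The coordinate functions are harmonic. -/
theorem laplacian_coord (x : E3) (i : Fin 3) : (Δ fun y : E3 => y i) x = 0 := by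
  have hD : fderiv ℝ (fun y : E3 => y i) = fun _ => EuclideanSpace.proj (𝕜 := ℝ) (ι := Fin 3) i := by
    funext y
    have h : HasFDerivAt (fun y : E3 => y i) (EuclideanSpace.proj (𝕜 := ℝ) (ι := Fin 3) i) y :=
      (EuclideanSpace.proj (𝕜 := ℝ) (ι := Fin 3) i).hasFDerivAt
    exact h.fderiv
  rw [congrFun (InnerProductSpace.laplacian_eq_iteratedFDeriv_orthonormalBasis _
    (EuclideanSpace.basisFun (Fin 3) ℝ)) x]
  simp [iteratedFDeriv_two_apply, hD]

/-- A product of two DISTINCT coordinates (times a constant) is harmonic. -/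
theorem laplacian_const_mul_coord_mul_coord (k : ℝ) {i j : Fin 3} (hij : i ≠ j) (x : E3) :
    (Δ fun y : E3 => k * y i * y j) x = 0 := by
  have hχ : ContDiff ℝ 2 (fun y : E3 => k * y i) := contDiff_const.mul (EuclideanSpace.proj (𝕜 := ℝ) (ι := Fin 3) i).contDiff
  have hf : ContDiff ℝ 2 (fun y : E3 => y j) := (EuclideanSpace.proj (𝕜 := ℝ) (ι := Fin 3) j).contDiff
  have hci : ∀ {n : WithTop ℕ∞}, ContDiff ℝ n (fun y : E3 => y i) := fun {n} =>
    (EuclideanSpace.proj (𝕜 := ℝ) (ι := Fin 3) i).contDiff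
  have hΔχ : (Δ fun y : E3 => k * y i) x = 0 := by
    have h := InnerProductSpace.laplacian_smul (x := x) k ((hci (n := 2)).contDiffAt)
    have hfun : (k • fun y : E3 => y i) = fun y : E3 => k * y i := by funext y; simp
    rw [hfun] at h
    rw [h, laplacian_coord, smul_zero]
  have hdχ : ∀ m : Fin 3, fderiv ℝ (fun y : E3 => k * y i) x (EuclideanSpace.single m (1 : ℝ))
      = k * (if i = m then 1 else 0) := by
    intro m
    rw [fderiv_const_mul ((hci (n := 1)).differentiable (by simp) x)]
    simp only [_root_.FunLike.coe_smul, Pi.smul_apply, smul_eq_mul, fderiv_coord_single]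
  rw [Tsai2021.laplacian_mul_eq hχ hf x, laplacian_coord, hΔχ]
  simp only [hdχ, fderiv_coord_single, Fin.sum_univ_three]
  fin_cases i <;> fin_cases j <;> simp_all


end Summit.NavierStokesRegularity.NavierStokesRegularity.Theorems.PoloidalLiouville.ErtelTower
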